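import Mathlib.RingTheory.Ideal.Quotient.Operations
import Mathlib.RingTheory.KrullDimension.Basic
import Mathlib.RingTheory.AlgebraicIndependent.Basic
import Mathlib.FieldTheory.IntermediateField.Adjoin.Basic
import Mathlib.SetTheory.Cardinal.ENat
import Literature.AlgebraicGeometry.Motives.MotivatedPeriodTorsor
import HarnessLib

/-!
# André's generalized period conjecture over a subfield `K ⊂ ℂ` (inequality form)

Definition request `defn-AndrePeriodConjectureOver` (route `HodgeConjecture/PeriodDeficiency`, crux
`GPCK`; also of interest to `Summits/KontsevichZagierPeriods`).

Let `K` be a field of characteristic zero with an embedding `σ : K →+* ℂ` (in the application a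
finitely generated extension of `ℚ̄` inside `ℂ`), `P : PeriodRealization K` the de Rham–Betti
comparison data (`Motives/PeriodComparison.lean`) and `X₀` a smooth projective `K`-variety of
dimension `n`, with comparison isomorphisms `c = (P.iso σ (X₀^m) i)_{m,i}` on its powers. The
**generalized (André–Grothendieck) period conjecture** predicts, for every subfield `K ⊂ ℂ` and every
motive `M` over `K`,

  `trdeg_ℚ K(periods of M) ≥ dim G_mot(M)`

(Y. André, letter of 2019-05-29 printed as the appendix of Bertolin 2020, `(?!)`, first published
as André 2004, §23.4; Bakker–Tsimerman 2025, Conj. 1.2 = Conj. 4.2 with Def. 4.3 — quoted on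
`AndrePeriodBound`). For `K ⊂ ℚ̄` it is the half `≥` of Grothendieck's period conjecture
`trdeg = dim G_mot` (André, loc. cit., `(??)`; the half `≤` is unconditional there); for `K` of
infinite transcendence degree it is empty; for toric 1-motives it is Schanuel's conjecture (tree:
`Literature.NumberTheory.Transcendental.OneMotiveToric.GPC`, `ToricPeriodConjecture`).

This file renders it for the motive of `X₀` — the Tannakian category `⟨h(X₀)⟩` generated by the
`hⁱ(X₀^m)` — in the vocabulary of `Motives/MotivatedPeriodTorsor.lean` (Bost–Charles 2014, Def. 2.4,
Def. 2.9: the torsor of motivated periods `Ω^And_{X₀}`, whose `R`-points are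
`P.MotivatedPeriodTorsor σ n X₀ R` and whose affine coordinates are `Coord`/`coord`, the comparison
being the complex point with coordinates `periodCoord`):

* `P.torsorIdeal σ n X₀` — the ideal `I(Ω^And_{X₀}) ⊆ K[Coord]` of polynomials over `K` in the
  coordinates vanishing at every `R`-point of the torsor, for every commutative `K`-algebra `R`
  (the ideal of the universal point); `P.TorsorPeriodConjecture σ n X₀` is literally
  `ker (ev_c) ≤ torsorIdeal` (`torsorPeriodConjecture_iff_ker_le`), and `torsorIdeal ≤ ker (ev_c)` holds
  for `X₀` smooth projective (`torsorIdeal_le_ker`, the comparison is a point).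
* `P.FormalMotivatedPeriodRing σ n X₀ := K[Coord] ⧸ torsorIdeal` — the affine coordinate ring `O(Ω^And_{X₀})`,
  i.e. the ring of **formal (motivated) periods** of `X₀` (Huber–Müller-Stach 2017, Def. 13.2.3:
  `P̃(M) = O(X(M))`, here for André's motivated torsor instead of Nori's), with the evaluation
  `P.formalPeriodEval σ hX : FormalMotivatedPeriodRing →ₐ[K] ℂ` at the comparison (`ev_M`, loc. cit.
  Def. 13.1.9) and `torsorPeriodConjecture_iff_injective`: Bost–Charles density `Z_{X₀} = Ω^And_{X₀}`
  ⟺ injectivity of `ev` (the form (1) of Huber–Müller-Stach 2017, Conj. 13.2.5).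
* `P.motivatedTorsorDim σ n X₀ := ringKrullDim (FormalMotivatedPeriodRing) : WithBot ℕ∞` — `dim Ω^And_{X₀}`,
  the rendering of the right-hand side `dim G_mot`: `Ω^And_{X₀}` is a torsor under André's motivated
  Galois group `G_And(X₀)_K` (Bost–Charles 2014, §2.1.2; André's letter: "`Π(M)` is a torsor under
  `G_mot(M)_k` … the latter dimension is `dim G_mot(M)`"), non-empty since `c ∈ Ω^And_{X₀}(ℂ)`
  (`comparisonPoint`), so `dim Ω^And_{X₀} = dim G_And(X₀)`, and for a pure motive André's
  motivated Galois group is "the" motivic Galois group of the printed statements (André's letter,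
  "Motivic Galois groups", after Arapura and Choudhury–Gallauer; see `AndrePeriodBound`).
* `P.periodFieldOver σ X₀ : IntermediateField ℚ ℂ` — `K(periods of ⟨h(X₀)⟩)`: the subfield of `ℂ`
  generated by `σ(K)` and all coordinates of the comparison, i.e. the periods
  `φ_ℂ(c(1 ⊗ v))` of all `Hⁱ(X₀^m)` (`periodSetOf_pow_subset_periodFieldOver`) and the coefficients
  of `c⁻¹` (which lie in the field generated by the former when `c` is invertible) — the field of
  definition of the comparison on `⟨h(X₀)⟩` (Bakker–Tsimerman 2025, Def. 4.3).
* `P.AndrePeriodBound σ n X₀ : Prop` — **André's period bound for `X₀` over `K`**, the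
  inequality the conjecture asserts for `X₀` (a predicate of the data, binders explicit):
  `dim Ω^And_{X₀} ≤ trdeg_ℚ K(periods)`, compared in `WithBot ℕ∞` through `Cardinal.toENat`;
  `andrePeriodBound_iff`: `∀ d : ℕ, d ≤ dim Ω^And_{X₀} → d ≤ trdeg_ℚ K(periods)`. (Requested as
  `AndrePeriodConjectureOver`; Literature hosts the vocabulary and this predicate, while the
  conjecture proper — the bound asserted for the classical data, quantified — is an obligation the
  consuming route files under `Summits/…`, gate rule `literature.conjecture`.)

## Design notes

* Mathlib has no motives, period torsors or motivic Galois groups (searched `period`, `torsor`,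
  `Tannak`, `motivic`); the tree's `NoriMotivicInterface` (`Motives/NoriInterface.lean`) posits formal
  periods abstractly for `k/ℚ` algebraic and `OneMotiveToric.GPC` is the toric 1-motive case. Used
  from Mathlib: `MvPolynomial.aeval`, `Ideal.Quotient.liftₐ`, `ringKrullDim`, `Algebra.trdeg`,
  `IntermediateField.adjoin`, `Cardinal.toENat`.
* `dim G_mot` is rendered as a Krull dimension, not as a transcendence degree of a function field:
  `Ω^And_{X₀}` need not be irreducible (connectedness is part of Grothendieck's conjecture, not of
  André's inequality), and all its components have the dimension of `G_And` (torsor). The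
  coordinates `Coord` range over all powers `X₀^m`, all degrees and all vectors, so `K[Coord]` has
  infinitely many variables; for the classical realization (Künneth) the coefficients on `X₀^m` are
  polynomials in those on `X₀` and `FormalMotivatedPeriodRing` is the finitely generated algebra
  `O(Ω^And_{X₀})` of Bost–Charles. No representability is claimed or used.
* `R`-points carry `[Algebra K R] [Algebra ℚ R]` as in `MotivatedPeriodTorsor` (a `K`-algebra, `K` of
  characteristic zero, is a `ℚ`-algebra in a unique way).
* The inequality is stated in `WithBot ℕ∞` (`ringKrullDim`) against `Cardinal.toENat` of the
  transcendence degree (a `Cardinal`): when `trdeg_ℚ K(periods)` is infinite the statement is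
  trivially true (`andrePeriodBound_of_aleph0_le`), as it should be (André: "for any
  `k ⊂ ℂ`"; content only when `trdeg_ℚ K < ∞`, e.g. `K` finitely generated); when the torsor has no
  points at all (`X₀` not smooth projective, junk data) `FormalMotivatedPeriodRing` is trivial, the dimension
  is `⊥` and the statement is vacuous — it is MEANINGFUL ONLY for `X₀` smooth projective of dimension
  `n` and the classical realization (`PeriodRealization.IsClassical`,
  `Motives/PeriodRealizationClassical.lean`), exactly like `TorsorPeriodConjecture`.
* STATUS. `AndrePeriodBound` is a `Prop`-valued PREDICATE of `(P, σ, n, X₀)` (like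
  `OneMotiveToric.GPC`, `NoriMotivicInterface.GrothendieckPeriodConjecture`,
  `BettiHodgeData.HodgeConjectureFor`): the statement of the conjecture for one variety, never an
  asserted or vendored fact; what it renders is CONJECTURAL (posed by André, unproved, implies
  Schanuel's conjecture; false with equality for transcendental `K`) — details and citations on its
  docstring. A route that assumes it (quantified over its data) files that closed statement as its
  own crux under `Summits/…` and states it with this predicate.
* Not proved here (needs `dim A = trdeg_K Frac(A)` for affine `K`-domains and finite generation of
  `O(Ω^And)`): for `K ⊂ ℚ̄`, `TorsorPeriodConjecture → AndrePeriodBound`, and the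
  unconditional bound `trdeg_ℚ K(periods) ≤ trdeg_ℚ K + dim Ω^And_{X₀}`.

## References

* Y. André, letter of 2019-05-29, appendix to C. Bertolin, *Third kind elliptic integrals and
  1-motives*, J. Pure Appl. Algebra 224 (2020) 106396, arXiv:1905.07247: `(?)`, `(??)`, `(?!)` and the
  Remark on the unconditional inequality. [Bertolin2020]
* Y. André, *Une introduction aux motifs*, Panoramas et Synthèses 17 (2004), §7.5, §23.4. [Andre2004]
* B. Bakker, J. Tsimerman, *Functional transcendence of periods and the geometric André–Grothendieck
  period conjecture*, Forum Math. Sigma 13 (2025) e97, arXiv:2208.05182: Conj. 1.2, Thm. 1.1, Def. 4.3,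
  Conj. 4.1, Conj. 4.2, Ex. 4.4, Thm. 4.25. [BakkerTsimerman2025]
* J.-B. Bost, F. Charles, *Some remarks concerning the Grothendieck period conjecture*, J. reine
  angew. Math. 714 (2016), arXiv:1307.1045: §2.1.2, Def. 2.4, Def. 2.9, Cor. 2.11, Conj. 2.12.
  [BostCharles2014]
* A. Huber, S. Müller-Stach, *Periods and Nori Motives*, Ergebnisse 65 (2017), Def. 11.1.1,
  Def. 13.1.9, Def. 13.2.3, Rem. 13.2.4, Conj. 13.2.5 (authors' 2015 draft of Part III, held:
  Conj. 12.2.5, Prop. 12.2.8–12.2.9, Cor. 12.2.13). [HuberMullerStachPeriods2017]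
* D. Arapura, *An abelian category of motivic sheaves*, Adv. Math. 233 (2013), arXiv:0801.0261
  (pure Nori motives vs. André's motivated motives). [Arapura2013]
* A. Huber, G. Wüstholz, *Transcendence and Linear Relations of 1-Periods* (2022), Prologue.
  [HuberWustholz2022]
-/

open CategoryTheory AlgebraicGeometry Opposite
open scoped TensorProduct

noncomputable section

namespace Literature.AlgebraicGeometry.Motives

namespace PeriodRealization

variable {K : Type} [Field K] [CharZero K] (P : PeriodRealization K) (σ : K →+* ℂ) (n : ℕ)
  (X₀ : SchemeOver K)

/-! ### The ideal and the affine ring of the torsor of motivated periods -/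

/-- The **ideal of the torsor of motivated periods** `I(Ω^And_{X₀}) ⊆ K[Coord]`: the polynomials
over `K` in the affine coordinates `Coord` (coefficients of the `f_{m,i}` and of their inverses)
that vanish at every `R`-point `f` of `Ω^And_{X₀}` (`MotivatedPeriodTorsor`), for every commutative
`K`-algebra `R` — the ideal of the universal point; `Ω^And_{X₀}` is the closed subscheme of
`Iso(H_dR, H_B ⊗ K)` cut out by the classes of motivated cycles on the powers of `X₀`
(Bost–Charles 2014, Def. 2.4 and Def. 2.9, `K = ℚ̄`). [cite: BostCharles2014, Def. 2.4 and Def. 2.9] -/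
def torsorIdeal : Ideal (MvPolynomial (P.Coord σ X₀) K) where
  carrier := {Φ | ∀ (R : Type) [CommRing R] [Algebra K R] [Algebra ℚ R]
    (f : P.MotivatedPeriodTorsor σ n X₀ R), MvPolynomial.aeval f.coord Φ = 0}
  add_mem' := fun {Φ Ψ} hΦ hΨ R _ _ _ f => by
    rw [map_add, hΦ R f, hΨ R f, add_zero]
  zero_mem' := fun R _ _ _ f => map_zero _
  smul_mem' := fun c {Φ} hΦ R _ _ _ f => by
    rw [smul_eq_mul, map_mul, hΦ R f, mul_zero]

variable {P σ n X₀} in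
/-- Membership in `torsorIdeal`: `Φ` vanishes at every `R`-point of the torsor, for every `R`. [folklore] -/
theorem mem_torsorIdeal_iff {Φ : MvPolynomial (P.Coord σ X₀) K} :
    Φ ∈ P.torsorIdeal σ n X₀ ↔ ∀ (R : Type) [CommRing R] [Algebra K R] [Algebra ℚ R]
      (f : P.MotivatedPeriodTorsor σ n X₀ R), MvPolynomial.aeval f.coord Φ = 0 :=
  Iff.rfl

/-- `TorsorPeriodConjecture` (the comparison is `K`-Zariski dense in `Ω^And_{X₀}`,
`Z_{X₀} = Ω^And_{X₀}`, Bost–Charles 2014, Conj. 2.12 with Cor. 2.11) is literally the inclusion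
`I(c) ≤ I(Ω^And_{X₀})` of the ideal of the comparison point (the kernel of the evaluation
`Φ ↦ Φ(c)`, `c = periodCoord`) in `torsorIdeal`. [cite: BostCharles2014, Conj. 2.12 with Cor. 2.11] -/
theorem torsorPeriodConjecture_iff_ker_le :
    P.TorsorPeriodConjecture σ n X₀ ↔
      RingHom.ker (MvPolynomial.aeval (R := K) (P.periodCoord σ X₀)) ≤ P.torsorIdeal σ n X₀ := by
  rw [SetLike.le_def]
  exact forall_congr' fun Φ => by rw [RingHom.mem_ker]; rfl

/-- For `X₀` smooth projective of dimension `n`, the comparison is a complex point of the torsor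
(`comparisonPoint`, Bost–Charles 2014, Cor. 2.11: `Z_X ⊂ Ω^And_X`), hence every polynomial in
`I(Ω^And_{X₀})` vanishes at the periods: `torsorIdeal ≤ ker (Φ ↦ Φ(c))`. [cite: BostCharles2014, Cor. 2.11] -/
theorem torsorIdeal_le_ker (hX : IsSmoothProjective n X₀) :
    P.torsorIdeal σ n X₀ ≤ RingHom.ker (MvPolynomial.aeval (R := K) (P.periodCoord σ X₀)) := by
  intro Φ hΦ
  rw [RingHom.mem_ker, ← coord_comparisonPoint P σ hX]
  exact hΦ (AlongHom ℂ σ) (P.comparisonPoint σ hX)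

/-- For `X₀` smooth projective the torsor of motivated periods has a point (the comparison), so its
ideal is proper: `1 ∉ I(Ω^And_{X₀})`. [folklore] -/
theorem torsorIdeal_ne_top (hX : IsSmoothProjective n X₀) : P.torsorIdeal σ n X₀ ≠ ⊤ := by
  intro h
  have h1 : (1 : MvPolynomial (P.Coord σ X₀) K) ∈ P.torsorIdeal σ n X₀ := h ▸ Submodule.mem_top
  have h1' := RingHom.mem_ker.mp (P.torsorIdeal_le_ker σ n X₀ hX h1)
  rw [map_one] at h1'
  exact one_ne_zero h1'

/-- The **ring of formal motivated periods** of `X₀`, i.e. the affine coordinate ring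
`O(Ω^And_{X₀}) = K[Coord] ⧸ I(Ω^And_{X₀})` of the torsor of motivated periods (Huber–Müller-Stach
2017, Def. 13.2.3: the ring of formal periods `P̃(M) = O(X(M))` of the torsor `X(M)` of
isomorphisms between de Rham and singular cohomology on `⟨M⟩`; here for André's torsor
`Ω^And_{X₀}` of Bost–Charles 2014, Def. 2.9, in place of Nori's). An `abbrev`, so that the quotient
`K`-algebra structure is found by unification. [cite: HuberMullerStachPeriods2017, Def. 13.2.3] -/
abbrev FormalMotivatedPeriodRing : Type :=
  MvPolynomial (P.Coord σ X₀) K ⧸ P.torsorIdeal σ n X₀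

/-- For `X₀` smooth projective the ring of formal motivated periods is non-trivial (the torsor has
the complex point `c`; `torsorIdeal_ne_top`). [folklore] -/
theorem nontrivial_formalMotivatedPeriodRing (hX : IsSmoothProjective n X₀) :
    Nontrivial (P.FormalMotivatedPeriodRing σ n X₀) :=
  Ideal.Quotient.nontrivial_iff.mpr (P.torsorIdeal_ne_top σ n X₀ hX)

/-- The **dimension of the torsor of motivated periods** `dim Ω^And_{X₀}`, as the Krull dimension of
its affine coordinate ring `FormalMotivatedPeriodRing` (in `WithBot ℕ∞`; `⊥` iff the ring is trivial, i.e. the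
torsor has no points over any `R`). Since `Ω^And_{X₀}` is a torsor under André's motivated Galois
group `G_And(X₀)_K` with a complex point (the comparison), this is `dim G_And(X₀)`, the right-hand
side `dim G_mot(M)` of the period conjectures for the motive of `X₀` (André's letter in Bertolin
2020: "`Π(M)` is a torsor under `G_mot(M)_k` … the latter dimension is `dim G_mot(M)`";
Bost–Charles 2014, §2.1.2; Huber–Müller-Stach 2017, Rem. 13.2.4). [cite: Bertolin2020, appendix: letter of Y. André, Period torsors] -/
def motivatedTorsorDim : WithBot ℕ∞ :=
  ringKrullDim (P.FormalMotivatedPeriodRing σ n X₀)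

/-- `motivatedTorsorDim` unfolds to the Krull dimension of `FormalMotivatedPeriodRing`. [folklore] -/
theorem motivatedTorsorDim_def :
    P.motivatedTorsorDim σ n X₀ = ringKrullDim (P.FormalMotivatedPeriodRing σ n X₀) := rfl

/-- For `X₀` smooth projective the torsor is non-empty, so `0 ≤ dim Ω^And_{X₀}` (the dimension is
not the junk value `⊥`). [folklore] -/
theorem motivatedTorsorDim_nonneg (hX : IsSmoothProjective n X₀) :
    0 ≤ P.motivatedTorsorDim σ n X₀ := by
  have := P.nontrivial_formalMotivatedPeriodRing σ n X₀ hX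
  exact ringKrullDim_nonneg_of_nontrivial

/-! ### Evaluation at the comparison -/

section Eval

variable {n X₀}

/-- The **evaluation of formal motivated periods at the comparison**,
`ev : O(Ω^And_{X₀}) →ₐ[K] ℂ`, `Φ ↦ Φ(c)` (`ℂ` as a `K`-algebra through `σ`, `AlongHom ℂ σ`): the
`K`-algebra map induced on the quotient by `Φ ↦ aeval periodCoord Φ`, well defined for `X₀` smooth
projective by `torsorIdeal_le_ker` (Huber–Müller-Stach 2017, Def. 13.1.9, `ev_M : P̃(M) → ℂ`, for
André's torsor; its image is the `K`-algebra generated by the periods of the powers of `X₀` and the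
coefficients of `c⁻¹`). [cite: HuberMullerStachPeriods2017, Def. 13.1.9] -/
def formalPeriodEval (hX : IsSmoothProjective n X₀) : P.FormalMotivatedPeriodRing σ n X₀ →ₐ[K] AlongHom ℂ σ :=
  Ideal.Quotient.liftₐ (P.torsorIdeal σ n X₀) (MvPolynomial.aeval (P.periodCoord σ X₀))
    fun _ hΦ => RingHom.mem_ker.mp (P.torsorIdeal_le_ker σ n X₀ hX hΦ)

/-- `ev` on the class of a polynomial `Φ` is `Φ(c)`, the value at the period coordinates. [folklore] -/
@[simp]
theorem formalPeriodEval_mk (hX : IsSmoothProjective n X₀) (Φ : MvPolynomial (P.Coord σ X₀) K) :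
    P.formalPeriodEval σ hX (Ideal.Quotient.mk (P.torsorIdeal σ n X₀) Φ) =
      MvPolynomial.aeval (P.periodCoord σ X₀) Φ :=
  rfl

/-- **Density ⟺ injectivity of the evaluation.** For `X₀` smooth projective of dimension `n`,
`TorsorPeriodConjecture` (`Z_{X₀} = Ω^And_{X₀}`: the comparison is `K`-Zariski dense in the torsor
of motivated periods, Bost–Charles 2014, Conj. 2.12 with Cor. 2.11) holds iff the evaluation
`ev : O(Ω^And_{X₀}) → ℂ` at the comparison is injective — the form (1) "the evaluation map
`P̃(M) → ℂ` is injective" of the Grothendieck conjecture in Huber–Müller-Stach 2017, Conj. 13.2.5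
(there for Nori's torsor and `k/ℚ` algebraic), equivalently André's `(?)` "ϖ maps to the generic
point of `Π(M)`". Real proof: both say `ker (Φ ↦ Φ(c)) = I(Ω^And_{X₀})`. [cite: HuberMullerStachPeriods2017, Conj. 13.2.5 (1)] -/
theorem torsorPeriodConjecture_iff_injective (hX : IsSmoothProjective n X₀) :
    P.TorsorPeriodConjecture σ n X₀ ↔ Function.Injective (P.formalPeriodEval σ hX) := by
  rw [injective_iff_map_eq_zero]
  constructor
  · intro h x hx
    obtain ⟨Φ, rfl⟩ := Ideal.Quotient.mk_surjective x
    rw [formalPeriodEval_mk] at hx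
    exact Ideal.Quotient.eq_zero_iff_mem.mpr (h Φ hx)
  · intro h Φ hΦ R _ _ _ f
    have h0 : Ideal.Quotient.mk (P.torsorIdeal σ n X₀) Φ = 0 :=
      h _ (by rw [formalPeriodEval_mk, hΦ])
    exact (Ideal.Quotient.eq_zero_iff_mem.mp h0) R f

end Eval

/-! ### The field generated over `K` by the periods -/

variable {n} in
/-- The field **`K(periods of ⟨h(X₀)⟩) ⊆ ℂ`**: the subfield of `ℂ` generated by `σ(K)` and the
coordinates of the comparison point — the periods `φ_ℂ(c(1 ⊗ v))` of all `Hⁱ(X₀^m)` along `σ` and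
the coefficients `ψ_ℂ(c⁻¹(1 ⊗ w))` of the inverse comparison — i.e. the field of definition of the
comparison isomorphism on the Tannakian category generated by `h(X₀)` (Bakker–Tsimerman 2025,
Def. 4.3: "`k(periods_ι of M) ⊂ ℂ` … the field of definition of the comparison `φ_M`. Concretely
… obtained by adjoining the periods of `k`-rational de Rham classes of `M` to `k`"; André's
`k(periods(M))`). As an intermediate field between `ℚ` and `ℂ`, so that `Algebra.trdeg ℚ` applies
(as in `OneMotiveToric.periodField`). [cite: BakkerTsimerman2025, Def. 4.3] -/
def periodFieldOver : IntermediateField ℚ ℂ :=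
  IntermediateField.adjoin ℚ
    (Set.range σ ∪ Set.range fun x : P.Coord σ X₀ => AlongHom.equiv σ (P.periodCoord σ X₀ x))

/-- `σ(K) ⊆ K(periods)`. [folklore] -/
theorem apply_mem_periodFieldOver (a : K) : σ a ∈ P.periodFieldOver σ X₀ :=
  IntermediateField.subset_adjoin ℚ _ (Or.inl ⟨a, rfl⟩)

/-- Every coordinate of the comparison point (a period of a power of `X₀`, or a coefficient of the
inverse comparison) lies in `K(periods)`. [folklore] -/
theorem periodCoord_mem_periodFieldOver (x : P.Coord σ X₀) :
    AlongHom.equiv σ (P.periodCoord σ X₀ x) ∈ P.periodFieldOver σ X₀ :=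
  IntermediateField.subset_adjoin ℚ _ (Or.inr ⟨x, rfl⟩)

/-- The periods `∫_γ ω` of every `Hⁱ(X₀^m)` along `σ` (`P.periodSetOf`, Huber–Müller-Stach 2017,
Def. 11.1.1) lie in `K(periods)`: they are the coordinates `(m, i, ω, γ)` of the comparison. [folklore] -/
theorem periodSetOf_pow_subset_periodFieldOver (m i : ℕ) :
    P.periodSetOf σ (X₀.pow m) i ⊆ (P.periodFieldOver σ X₀ : Set ℂ) := by
  intro x hx
  obtain ⟨v, φ, rfl⟩ := P.mem_periodSetOf_iff.mp hx
  exact P.periodCoord_mem_periodFieldOver σ X₀ (.iso m i v φ)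

end PeriodRealization

/-! ### The statement of the conjecture -/

namespace PeriodRealization

/-- **André's period bound for `X₀` over `K ⊂ ℂ`**: the inequality
`trdeg_ℚ K(periods of ⟨h(X₀)⟩) ≥ dim Ω^And_{X₀}` (`= dim G_And(X₀)`) asserted for `X₀` by André's
generalized (André–Grothendieck) period conjecture (requested as `AndrePeriodConjectureOver`),
as a `Prop`-valued PREDICATE of the comparison data `P`, the embedding `σ`, the dimension `n` and
the `K`-variety `X₀` (binders explicit: one instance of the conjecture per `(P, σ, X₀)`, like
`OneMotiveToric.GPC`; the quantified statement a route assumes is for the route to file as its own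
crux, an obligation under `Summits/…`). Rendered as `motivatedTorsorDim ≤ toENat (trdeg_ℚ periodFieldOver)`
in `WithBot ℕ∞` (`andrePeriodBound_iff`: `∀ d : ℕ, d ≤ dim → d ≤ trdeg`). What it renders is
CONJECTURAL — posed, never proved: Y. André, *Une introduction aux motifs* (2004), §23.4, as recalled
in André's letter printed in Bertolin 2020 (appendix): "(Generalized) period conjecture over an
arbitrary subfield of `ℂ` … it predicts that for any `k ⊂ ℂ`, and any (pure or mixed) motive `M`
defined over `k`, `(?!) transc.deg_ℚ k(periods(M)) ≥ dim G_mot(M)`. Of course, since `k` may contain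
the periods, one cannot hope for an equality"; Bakker–Tsimerman 2025, Conj. 1.2 ("André–Grothendieck
period conjecture. Let `M` a Nori motive over `K`. Then `trdeg_ℚ K(periods of M) ≥ dim G_mot(M)`")
= Conj. 4.2 with Def. 4.3. Here `M` is the motive of the smooth projective `X₀` (the Tannakian
category generated by the `hⁱ(X₀^m)`), `K(periods of M)` is `periodFieldOver` and `dim G_mot(M)` is
rendered by the dimension `motivatedTorsorDim` of the torsor of motivated periods `Ω^And_{X₀}`
(Bost–Charles 2014, Def. 2.9), a torsor under André's motivated Galois group, which for a pure
motive is "the" motivic Galois group of the printed statements (André's letter, "Motivic Galois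
groups", after Arapura and Choudhury–Gallauer: the pure motivic Galois group of André 1996 is the
pro-reductive quotient of Nori's = Ayoub's, and `G_mot(M)` is reductive for `M` pure).
WARNINGS. (i) MEANINGFUL ONLY for `X₀` smooth projective of dimension `n` and the CLASSICAL
realization `P` (`PeriodRealization.IsClassical`); over the bare hypothesis structure, or when the
torsor has no point, it may hold or fail for junk reasons (empty torsor ⇒ `motivatedTorsorDim = ⊥` ⇒
true). (ii) For `K ⊂ ℚ̄` it is the half `≥` of GROTHENDIECK'S period conjecture `trdeg_ℚ = dim G_mot`
(André's `(??)`; Huber–Müller-Stach 2017, Conj. 13.2.5 (3); the tree's `TorsorPeriodConjecture` /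
`NoriMotivicInterface.GrothendieckPeriodConjectureTrdeg`), whose other half is unconditional; with
EQUALITY it is FALSE for `K` transcendental (take the periods into `K`). (iii) For
`trdeg_ℚ K(periods) = ∞` it is trivially true (`andrePeriodBound_of_aleph0_le`): the content
is for `K` of finite transcendence degree. (iv) It implies Schanuel's conjecture (toric 1-motives;
André's letter; Bakker–Tsimerman 2025, Ex. 4.4; tree: `ToricPeriodConjecture`) and is unproved beyond
1-motives (Huber–Wüstholz 2022, Prologue); its functional analogue is Bakker–Tsimerman 2025, Thm. 1.1.
Hence no `_holds` is to be expected for the classical data: use it only as a hypothesis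
`(h : P.AndrePeriodBound σ n X₀)` — the conditional input `GPCK` of route
`HodgeConjecture/PeriodDeficiency`. [cite: Bertolin2020, appendix (letter of Y. André), (?!); BakkerTsimerman2025, Conj. 1.2 and Conj. 4.2 with Def. 4.3] -/
def AndrePeriodBound {K : Type} [Field K] [CharZero K] (P : PeriodRealization K)
    (σ : K →+* ℂ) (n : ℕ) (X₀ : SchemeOver K) : Prop :=
  P.motivatedTorsorDim σ n X₀ ≤
    ((Cardinal.toENat (Algebra.trdeg ℚ (P.periodFieldOver σ X₀)) : ℕ∞) : WithBot ℕ∞)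

variable {K : Type} [Field K] [CharZero K] (P : PeriodRealization K) (σ : K →+* ℂ) (n : ℕ)
  (X₀ : SchemeOver K)

/-- `AndrePeriodBound` in elementary terms: every natural number bounded by the
dimension of the torsor of motivated periods is bounded by the transcendence degree of
`K(periods)` over `ℚ` — `trdeg_ℚ K(periods) ≥ dim Ω^And_{X₀}` with the dimension read in
`WithBot ℕ∞` and the transcendence degree in `Cardinal`. [folklore] -/
theorem andrePeriodBound_iff :
    P.AndrePeriodBound σ n X₀ ↔
      ∀ d : ℕ, (d : WithBot ℕ∞) ≤ P.motivatedTorsorDim σ n X₀ →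
        (d : Cardinal) ≤ Algebra.trdeg ℚ (P.periodFieldOver σ X₀) := by
  unfold AndrePeriodBound
  generalize P.motivatedTorsorDim σ n X₀ = a
  generalize Algebra.trdeg ℚ (P.periodFieldOver σ X₀) = c
  constructor
  · intro h d hd
    have hd' : ((d : ℕ∞) : WithBot ℕ∞) ≤ (Cardinal.toENat c : WithBot ℕ∞) := hd.trans h
    exact Cardinal.natCast_le_toENat.mp (WithBot.coe_le_coe.mp hd')
  · intro h
    induction a using WithBot.recBotCoe with
    | bot => exact bot_le
    | coe a =>
      refine WithBot.coe_le_coe.mpr (ENat.forall_natCast_le_iff_le.mp fun d hd => ?_)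
      exact Cardinal.natCast_le_toENat.mpr (h d (WithBot.coe_le_coe.mpr hd))

/-- When `K(periods)` has infinite transcendence degree over `ℚ` (e.g. `trdeg_ℚ K = ∞`), the
statement holds trivially: its content is for `K` of finite transcendence degree (André: "for any
`k ⊂ ℂ`"). [folklore] -/
theorem andrePeriodBound_of_aleph0_le
    (h : Cardinal.aleph0 ≤ Algebra.trdeg ℚ (P.periodFieldOver σ X₀)) :
    P.AndrePeriodBound σ n X₀ := by
  unfold AndrePeriodBound
  rw [Cardinal.toENat_eq_top.mpr h, WithBot.coe_top]
  exact le_top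

/-- Conversely to `andrePeriodBound_of_aleph0_le`: if the torsor of motivated periods has
dimension at most `d` and `K(periods)` has transcendence degree at least `d` over `ℚ`, the statement
holds for `X₀` (the shape in which known transcendence results settle instances). [folklore] -/
theorem andrePeriodBound_of_le {d : ℕ} (hdim : P.motivatedTorsorDim σ n X₀ ≤ d)
    (htr : (d : Cardinal) ≤ Algebra.trdeg ℚ (P.periodFieldOver σ X₀)) :
    P.AndrePeriodBound σ n X₀ := by
  rw [andrePeriodBound_iff]
  intro e he
  have hed : (e : WithBot ℕ∞) ≤ d := he.trans hdim
  exact (Nat.cast_le.mpr (Nat.cast_le.mp hed)).trans htr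

end PeriodRealization

end Literature.AlgebraicGeometry.Motives

end
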